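import Summits.CriticalPhenomena.PercolationContinuityZ3.Theorems.Transplant.SkelPhiWinChainF
import Summits.CriticalPhenomena.PercolationContinuityZ3.Theorems.Transplant.KNCells2ChainAppend
import HarnessLib

/-!
# N1 (the `{±1}` node), LEVEL 1, (C) column file (C-N1): the TARGET CHAIN OVER TWO WINDOWS — a segment of `S₁.N + 1` steps read through a
# planar window `𝒲₁` (frame 1) followed by a segment of `S₂.N + 1` steps read through ANOTHER planar window `𝒲₂` of the SAME exploration graph
# (frame 2), glued by ONE cross-frame containment `𝒲₁.coreTF S₁ S₁.N ⊆ X^{(0)}_0` of the second segment (the frame change).  Output = the linked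
# step family with constant source, per-step `KitsAt`, rim excess and the two end identities — exactly the data the habitat corridor residue
# `Skel.ReachOblAtHN` asks for (C-FUNNEL.md: phase 1 over the coarse skeleton ρ, phases 2–3 over the run frame).  `KNLevels`' chain lemmas are
# frame-agnostic; `lt_real_of_chainF` (p1-g11) is the one-window case.

builds on p205010 (kernel theorem, internal audit signed; external expert review pending) — nothing in this file uses p205010; nothing here is a
claim about the open node `SamePDropOfSkeletonNeg`.
Lane `prim-bschramm`, seat `prim-bschramm-p5` (gen 8; (C) lineage); helper file (`--supports stmt-CriticalPhenomena-4575`).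
* §1 `WinChainData.stepAF₂ / coreTF₂` (the concatenated step / true-target families, `ChainPlanar.pw` at the cut `S₁.N`), `stepAF₂_left/_right`,
  `coreTF₂_left/_right`, `stepAF₂_o`;
* §2 **`WinChainData.chain₂`**: from the per-segment window-chain hypotheses of `kitsAt_stepAF` (both segments), equal sources, the cross link and the
  rim excess: `∃`-free conclusion listing, for `s i := stepAF₂ … i`, `T' i := coreTF₂ … i` on `Fin (S₁.N + 1 + S₂.N + 1)`: constant source, links,
  `T' ⊆ T`, `KitsAt`, excess `≤ η`, `(s 0).L.X 0 = 𝒲₁.W (S₁.core 0)`, `T' last = 𝒲₂.coreTF S₂ S₂.N`.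
[cite: KozmaNitzan2024, §4 Lemma 11 (pp. 22–23), Lemma 12 (pp. 23–25), p. 20 (Step IV)]
-/

noncomputable section

open MeasureTheory ProbabilityTheory
open scoped ENNReal

namespace Summit.CriticalPhenomena.PercolationContinuityZ3.Theorems.Transplant

namespace Skelφ

open Literature.Probability.Percolation Literature.Probability.LatticeModels SimpleGraph
open Literature.Probability.Percolation.KozmaNitzan
open KNLevels ChainPlanar

variable {V : Type} [DecidableEq V]

namespace WinChainData

variable {G' : SimpleGraph V} [G'.LocallyFinite]
variable (P₁ P₂ : WinChainData V) (𝒲₁ 𝒲₂ : PlanarWindow G') (S₁ S₂ : SchedFrame)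

/-! ## §1 The concatenated families -/

/-- **The concatenated step family**: steps `0 … N₁` of `(P₁, 𝒲₁, S₁)`, then steps `0 … N₂` of `(P₂, 𝒲₂, S₂)` shifted by `N₁ + 1`.
[cite: KozmaNitzan2024, §4 Lemma 12 (pp. 23–25)] -/
def stepAF₂ (k : ℕ) : TStep G' := pw S₁.N (fun k => P₁.stepAF 𝒲₁ S₁ k) (fun k => P₂.stepAF 𝒲₂ S₂ k) k

/-- **The concatenated true-target family.** [cite: KozmaNitzan2024, §4 Lemma 12] -/
def coreTF₂ (k : ℕ) : Finset V := pw S₁.N (fun k => 𝒲₁.coreTF S₁ k) (fun k => 𝒲₂.coreTF S₂ k) k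

/-- First segment of the step family. [folklore] -/
theorem stepAF₂_left {k : ℕ} (hk : k ≤ S₁.N) : stepAF₂ P₁ P₂ 𝒲₁ 𝒲₂ S₁ S₂ k = P₁.stepAF 𝒲₁ S₁ k := pw_of_le _ _ hk

/-- Second segment of the step family. [folklore] -/
theorem stepAF₂_right (j : ℕ) : stepAF₂ P₁ P₂ 𝒲₁ 𝒲₂ S₁ S₂ (S₁.N + 1 + j) = P₂.stepAF 𝒲₂ S₂ j := pw_add _ _ _ _

/-- First segment of the true-target family. [folklore] -/
theorem coreTF₂_left {k : ℕ} (hk : k ≤ S₁.N) : coreTF₂ 𝒲₁ 𝒲₂ S₁ S₂ k = 𝒲₁.coreTF S₁ k := pw_of_le _ _ hk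

/-- Second segment of the true-target family. [folklore] -/
theorem coreTF₂_right (j : ℕ) : coreTF₂ 𝒲₁ 𝒲₂ S₁ S₂ (S₁.N + 1 + j) = 𝒲₂.coreTF S₂ j := pw_add _ _ _ _

/-- The source of every concatenated step is `P₁.o` (given `P₂.o = P₁.o`). [folklore] -/
theorem stepAF₂_o (ho : P₂.o = P₁.o) (k : ℕ) : (stepAF₂ P₁ P₂ 𝒲₁ 𝒲₂ S₁ S₂ k).L.o = P₁.o := by
  by_cases h : k ≤ S₁.N
  · rw [stepAF₂_left _ _ _ _ _ _ h]; rfl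
  · obtain ⟨j, rfl⟩ : ∃ j, k = S₁.N + 1 + j := ⟨k - (S₁.N + 1), by omega⟩
    rw [stepAF₂_right]; exact ho

/-! ## §2 The two-window chain -/

/-- **THE TARGET CHAIN OVER TWO WINDOWS.**  Segment 1: `(P₁, 𝒲₁, S₁)`, segment 2: `(P₂, 𝒲₂, S₂)` in the same exploration graph `G'`, same source;
per segment the hypotheses of `kitsAt_stepAF` at every step (subbox regions under `W'`, finite support, source off the regions, level window, count,
per-level kit clause), nonempty true targets, rim parts inside the regions and rim excess `≤ η`; the CROSS LINK `𝒲₁.coreTF S₁ S₁.N ⊆ 𝒲₂.W (S₂.core 0)`.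
Then the concatenated families `s = stepAF₂`, `T' = coreTF₂` on `Fin (S₁.N + 1 + S₂.N + 1)` form a linked chain with constant source, `T' ⊆ T`,
`KitsAt` at every step, excess `≤ η`, first level `𝒲₁.W (S₁.core 0)` and last true target `𝒲₂.coreTF S₂ S₂.N`.
[cite: KozmaNitzan2024, §4 Lemma 11 (pp. 22–23), Lemma 12 (pp. 23–25), p. 20 (Step IV)] -/
theorem chain₂ (ho : P₂.o = P₁.o)
    (hRl₁ : P₁.Rlev + 1 ≤ S₁.R') (hRim₁ : ∀ k, P₁.Rim k ⊆ 𝒲₁.stepDF S₁ k) (hTne₁ : ∀ k ≤ S₁.N, (𝒲₁.coreTF S₁ k).Nonempty)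
    (hRl₂ : P₂.Rlev + 1 ≤ S₂.R') (hRim₂ : ∀ k, P₂.Rim k ⊆ 𝒲₂.stepDF S₂ k) (hTne₂ : ∀ k ≤ S₂.N, (𝒲₂.coreTF S₂ k).Nonempty)
    (hx : 𝒲₁.coreTF S₁ S₁.N ⊆ 𝒲₂.W (S₂.core 0))
    {p : unitInterval} {W' : Sym2 V → unitInterval} {Δ' : ℕ} {δ η : ℝ}
    (hsub₁ : ∀ k ≤ S₁.N, IsSubbox G' W' p (𝒲₁.stepDF S₁ k)) (hfin₁ : FinSupp W' P₁.Sfin) (hDS₁ : ∀ k ≤ S₁.N, 𝒲₁.stepDF S₁ k ⊆ P₁.Sfin)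
    (ho₁ : ∀ k ≤ S₁.N, P₁.o ∉ 𝒲₁.stepDF S₁ k) (hoS₁ : P₁.o ∈ P₁.Sfin) (hj₁ : P₁.j₁ ≤ P₁.Rlev)
    (hcount₁ : 1 / (1 - (p : ℝ)) ^ (Δ' * P₁.N) ≤ δ * ((Finset.Icc P₁.j₀ P₁.j₁).card : ℝ))
    (hkits₁ : ∀ k ≤ S₁.N, ∀ j ∈ Finset.Icc P₁.j₀ P₁.j₁, ∃ (σ : SData V) (Sz : Finset V),
      SHyp (P₁.stepLF 𝒲₁ S₁ k) j σ ∧ σ.N ≤ P₁.N ∧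
      (1 - (p : ℝ) ^ σ.sB) ^ σ.k ≤ δ ∧ Sz ⊆ (P₁.stepLF 𝒲₁ S₁ k).X j ∧ Sz ⊆ 𝒲₁.stepDF S₁ k ∧
      (∀ x ∈ σ.K, ∀ e ∈ σ.seed x, e ∉ wireSet (↑Sz : Set V)) ∧ (∀ x ∈ σ.K, σ.face x ⊆ Sz) ∧
      (∀ x ∈ σ.K, 1 - 3 * δ ≤ (prodBernoulli W').real {ω | ∃ u ∈ σ.face x,
        1 - δ < (prodBernoulli (pinW W' (wireSet (↑Sz : Set V)) ω)).real
          (⋃ t ∈ P₁.coreEF 𝒲₁ S₁ k, openConnIn (↑(𝒲₁.stepDF S₁ k) : Set V) u t)}))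
    (hexc₁ : ∀ k ≤ S₁.N, (prodBernoulli W').real (⋃ t ∈ P₁.Rim k, openConn P₁.o t) ≤ η)
    (hsub₂ : ∀ k ≤ S₂.N, IsSubbox G' W' p (𝒲₂.stepDF S₂ k)) (hfin₂ : FinSupp W' P₂.Sfin) (hDS₂ : ∀ k ≤ S₂.N, 𝒲₂.stepDF S₂ k ⊆ P₂.Sfin)
    (ho₂ : ∀ k ≤ S₂.N, P₂.o ∉ 𝒲₂.stepDF S₂ k) (hoS₂ : P₂.o ∈ P₂.Sfin) (hj₂ : P₂.j₁ ≤ P₂.Rlev)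
    (hcount₂ : 1 / (1 - (p : ℝ)) ^ (Δ' * P₂.N) ≤ δ * ((Finset.Icc P₂.j₀ P₂.j₁).card : ℝ))
    (hkits₂ : ∀ k ≤ S₂.N, ∀ j ∈ Finset.Icc P₂.j₀ P₂.j₁, ∃ (σ : SData V) (Sz : Finset V),
      SHyp (P₂.stepLF 𝒲₂ S₂ k) j σ ∧ σ.N ≤ P₂.N ∧
      (1 - (p : ℝ) ^ σ.sB) ^ σ.k ≤ δ ∧ Sz ⊆ (P₂.stepLF 𝒲₂ S₂ k).X j ∧ Sz ⊆ 𝒲₂.stepDF S₂ k ∧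
      (∀ x ∈ σ.K, ∀ e ∈ σ.seed x, e ∉ wireSet (↑Sz : Set V)) ∧ (∀ x ∈ σ.K, σ.face x ⊆ Sz) ∧
      (∀ x ∈ σ.K, 1 - 3 * δ ≤ (prodBernoulli W').real {ω | ∃ u ∈ σ.face x,
        1 - δ < (prodBernoulli (pinW W' (wireSet (↑Sz : Set V)) ω)).real
          (⋃ t ∈ P₂.coreEF 𝒲₂ S₂ k, openConnIn (↑(𝒲₂.stepDF S₂ k) : Set V) u t)}))
    (hexc₂ : ∀ k ≤ S₂.N, (prodBernoulli W').real (⋃ t ∈ P₂.Rim k, openConn P₁.o t) ≤ η) :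
    let n := S₁.N + 1 + S₂.N
    let s : Fin (n + 1) → TStep G' := fun i => stepAF₂ P₁ P₂ 𝒲₁ 𝒲₂ S₁ S₂ i
    let T' : Fin (n + 1) → Finset V := fun i => coreTF₂ 𝒲₁ 𝒲₂ S₁ S₂ i
    (∀ i : Fin (n + 1), (s i).L.o = P₁.o) ∧
    (∀ i : Fin n, T' (Fin.castSucc i) ⊆ (s i.succ).L.X 0) ∧ (∀ i : Fin (n + 1), T' i ⊆ (s i).T) ∧
    (∀ i : Fin (n + 1), (s i).KitsAt W' p Δ' δ) ∧
    (∀ i : Fin (n + 1), (prodBernoulli W').real (⋃ t ∈ (s i).T \ T' i, openConn P₁.o t) ≤ η) ∧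
    (s 0).L.X 0 = 𝒲₁.W (S₁.core 0) ∧ T' (Fin.last n) = 𝒲₂.coreTF S₂ S₂.N := by
  intro n s T'
  -- per natural index: the step and target families and their facts, by cases at the cut
  have hfacts : ∀ k ≤ n, coreTF₂ 𝒲₁ 𝒲₂ S₁ S₂ k ⊆ (stepAF₂ P₁ P₂ 𝒲₁ 𝒲₂ S₁ S₂ k).T ∧
      (stepAF₂ P₁ P₂ 𝒲₁ 𝒲₂ S₁ S₂ k).KitsAt W' p Δ' δ ∧
      (prodBernoulli W').real (⋃ t ∈ (stepAF₂ P₁ P₂ 𝒲₁ 𝒲₂ S₁ S₂ k).T \ coreTF₂ 𝒲₁ 𝒲₂ S₁ S₂ k, openConn P₁.o t) ≤ η := by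
    intro k hk
    by_cases h : k ≤ S₁.N
    · rw [stepAF₂_left _ _ _ _ _ _ h, coreTF₂_left _ _ _ _ h]
      refine ⟨P₁.coreTF_subset_coreEF 𝒲₁ S₁ k, P₁.kitsAt_stepAF 𝒲₁ S₁ hRl₁ hRim₁ h (hTne₁ k h) (hsub₁ k h) hfin₁ (hDS₁ k h) (ho₁ k h) hoS₁ hj₁
        hcount₁ (hkits₁ k h), ?_⟩
      refine le_trans (measureReal_mono ?_ (measure_ne_top _ _)) (hexc₁ k h)
      intro ω hω
      simp only [Set.mem_iUnion, exists_prop] at hω ⊢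
      obtain ⟨t, ht, hωt⟩ := hω
      exact ⟨t, P₁.coreEF_sdiff_subset 𝒲₁ S₁ k ht, hωt⟩
    · obtain ⟨j, rfl⟩ : ∃ j, k = S₁.N + 1 + j := ⟨k - (S₁.N + 1), by omega⟩
      have hj : j ≤ S₂.N := by change S₁.N + 1 + j ≤ S₁.N + 1 + S₂.N at hk; omega
      rw [stepAF₂_right, coreTF₂_right]
      refine ⟨P₂.coreTF_subset_coreEF 𝒲₂ S₂ j, P₂.kitsAt_stepAF 𝒲₂ S₂ hRl₂ hRim₂ hj (hTne₂ j hj) (hsub₂ j hj) hfin₂ (hDS₂ j hj) (ho₂ j hj) hoS₂ hj₂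
        hcount₂ (hkits₂ j hj), ?_⟩
      refine le_trans (measureReal_mono ?_ (measure_ne_top _ _)) (hexc₂ j hj)
      intro ω hω
      simp only [Set.mem_iUnion, exists_prop] at hω ⊢
      obtain ⟨t, ht, hωt⟩ := hω
      exact ⟨t, P₂.coreEF_sdiff_subset 𝒲₂ S₂ j ht, hωt⟩
  -- the links, by cases: inside segment 1, at the frame change, inside segment 2
  have hlinks : ∀ k, k + 1 ≤ n → coreTF₂ 𝒲₁ 𝒲₂ S₁ S₂ k ⊆ (stepAF₂ P₁ P₂ 𝒲₁ 𝒲₂ S₁ S₂ (k + 1)).L.X 0 := by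
    intro k hk
    by_cases h : k + 1 ≤ S₁.N
    · rw [coreTF₂_left _ _ _ _ (by omega), stepAF₂_left _ _ _ _ _ _ h]
      exact P₁.coreTF_subset_X_zero_succ 𝒲₁ S₁ k
    · by_cases h' : k = S₁.N
      · subst h'
        rw [coreTF₂_left _ _ _ _ le_rfl, show S₁.N + 1 = S₁.N + 1 + 0 by omega, stepAF₂_right]
        show 𝒲₁.coreTF S₁ S₁.N ⊆ (P₂.stepLF 𝒲₂ S₂ 0).X 0
        rw [P₂.stepLF_X_zero 𝒲₂ S₂]
        exact hx
      · obtain ⟨j, rfl⟩ : ∃ j, k = S₁.N + 1 + j := ⟨k - (S₁.N + 1), by omega⟩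
        rw [coreTF₂_right, show S₁.N + 1 + j + 1 = S₁.N + 1 + (j + 1) by omega, stepAF₂_right]
        exact P₂.coreTF_subset_X_zero_succ 𝒲₂ S₂ j
  have hle : ∀ i : Fin (n + 1), (i : ℕ) ≤ n := fun i => Nat.lt_succ_iff.1 i.2
  refine ⟨fun i => stepAF₂_o P₁ P₂ 𝒲₁ 𝒲₂ S₁ S₂ ho i, fun i => ?_, fun i => (hfacts i (hle i)).1, fun i => (hfacts i (hle i)).2.1,
    fun i => (hfacts i (hle i)).2.2, ?_, ?_⟩
  · -- the links
    show coreTF₂ 𝒲₁ 𝒲₂ S₁ S₂ (Fin.castSucc i) ⊆ (stepAF₂ P₁ P₂ 𝒲₁ 𝒲₂ S₁ S₂ (i.succ : ℕ)).L.X 0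
    have e : ((i.succ : Fin (n + 1)) : ℕ) = (Fin.castSucc i : ℕ) + 1 := by simp
    rw [e]
    exact hlinks _ (by have := i.2; simp only [Fin.val_castSucc]; omega)
  · -- the first level is the window over the first core of segment 1
    show (stepAF₂ P₁ P₂ 𝒲₁ 𝒲₂ S₁ S₂ ((0 : Fin (n + 1)) : ℕ)).L.X 0 = 𝒲₁.W (S₁.core 0)
    rw [Fin.val_zero, stepAF₂_left _ _ _ _ _ _ (Nat.zero_le _)]
    exact P₁.stepLF_X_zero 𝒲₁ S₁ 0
  · -- the last true target is the last one of segment 2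
    show coreTF₂ 𝒲₁ 𝒲₂ S₁ S₂ ((Fin.last n : Fin (n + 1)) : ℕ) = 𝒲₂.coreTF S₂ S₂.N
    rw [Fin.val_last, show n = S₁.N + 1 + S₂.N from rfl, coreTF₂_right]

end WinChainData

end Skelφ

end Summit.CriticalPhenomena.PercolationContinuityZ3.Theorems.Transplant

end
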